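import Literature.AlgebraicGeometry.Motives.BettiRealization
import Literature.AlgebraicGeometry.HodgeTheory.HodgeFiltration
import Literature.AlgebraicGeometry.HodgeTheory.RationalClassesRingChange
import HarnessLib

/-!
# The Hodge-structure pin of a Betti–Hodge datum (light-weight home)

`BettiHodgeData ℂ` (`Motives/BettiRealization`) is a HYPOTHESIS STRUCTURE standing in for the
classical Betti–Hodge realization; its axioms do not determine the Hodge structures `B.hodge`
(the tree records exotic re-decorations: `BettiHodgeData.weil`, `.pureEven`, `.conjugate`), so every
statement reading `B.hodge hX i` as THE Hodge structure of `Hⁱ(X^an)` is made under a hypothesis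
predicate. `Motives/PeriodRealizationClassical` defines the full predicate
`BettiHodgeData.IsClassical` = (i)/(i') Hodge-structure pin + (ii-a) supports of cycle classes +
(ii-b) fundamental-class data; its import cone (real structure and complex conjugation of singular
cohomology, the Hodge decomposition files, Betti cycle classes, algebraic equivalence) carries a
dozen unproved named facts that consumers of the pin alone (Mumford–Tate / Hodge-locus statements:
route `HodgeConjecture/PeriodDeficiency`, items `DeficiencyBound`, `QbarGenericIsHodgeGeneric`,
`ClassicalGeometricVHS`; route `PeriodsPolice`) never use. This file is the light-weight home of
the pin (definition request `defn-BettiHodgeData.IsClassicalHodge`; pure refactoring, no new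
mathematics): it imports only `Motives/BettiRealization`, `HodgeTheory/HodgeFiltration` and
`HodgeTheory/RationalClassesRingChange` (the change of coefficient ring
`AlgebraicTopology/SingularHomology/CohomologyRingChange` with its `ℚ`-linearity / injectivity /
rational-classes API; import cone free of unproved named facts).

* `ringChangeBaseChange Y k : ℂ ⊗_ℚ Hᵏ(Y; ℚ) →ₗ[ℂ] Hᵏ(Y; ℂ)`, `c ⊗ a ↦ c • ι(a)`, the `ℂ`-linear
  extension of the change of coefficients `ι = singularCohomology.ringChange (ℚ ↪ ℂ) Y k`,
  `[u] ↦ [(ℚ ↪ ℂ) ∘ u]` (Hatcher 2002, §3.1 p. 198; Voisin I, §7.1.1: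
  `Hᵏ(X, ℂ) = Hᵏ(X, ℤ) ⊗ ℂ`). This is the SAME map as `Motives.ofRatClassBaseChange` of
  `PeriodRealizationClassical` (built there on `HodgeTheory.ofRatClass`, whose home
  `HodgeTheory/RealStructureSingular` is the heavy import) — the two change-of-coefficient maps
  `ofRatClass Y k` and `singularCohomology.ringChange (ℚ ↪ ℂ) Y k` agree DEFINITIONALLY (both send
  `[ζ]` to `[σ ↦ (ζ σ : ℂ)]`; cf. `HodgeTheory.ofRatClass_eq_ringChange`), so
  `ofRatClassBaseChange = ringChangeBaseChange`, `complexComparison = comparison`,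
  `hodgeModelComparison = modelComparison` hold by `rfl` and the projection
  `IsClassical → IsClassicalHodge` is the identity on the two clauses (all recorded in
  `PeriodRealizationClassical`, which imports this file). The `ringChange` spelling is also the one
  of `HodgeTheory/RationalClassesRingChange` (`isRationalClass_iff_exists_ringChange`, injectivity)
  and of `Motives/SummitCompatible`.
* `BettiHodgeData.comparison B X i : ℂ ⊗_ℚ Hⁱ(X) →ₗ[ℂ] Hⁱ(X(ℂ); ℂ)` (`B.iso ⊗ ℂ` followed by
  `ringChangeBaseChange`) and `BettiHodgeData.modelComparison B A i = Φ_A`,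
  `ℂ ⊗_ℚ Hⁱ(X) → Hⁱ(X^an; ℂ)` (followed by the pull-back `A.pullback` along the analytification
  `X^an → X(ℂ)` of a Hodge model `A`, a homeomorphism, Serre GAGA §2).
* `BettiHodgeData.IsClassicalHodge B` — the PIN, a `Prop`-valued structure with exactly the two
  clauses (i) `comap_hodgePQ` and (i') `comap_hodgeFiltration` of `BettiHodgeData.IsClassical`:
  for every smooth projective `X` of dimension `n`, every Hodge model `A : HodgeModel n X`, all
  `i`, `p + q = i`, `r`: `(A.hodgePQ i p q).comap Φ_A = (B.hodge hX i).piece p q` and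
  `(A.hodgeFiltration i r).comap Φ_A = (B.hodge hX i).F r` — "`B.hodge` IS the Hodge structure of
  `X^an`": both of Voisin's equivalent descriptions of the Hodge structure of weight `i` on
  `Hⁱ(X, ℤ)` of a compact Kähler manifold (Voisin, *Hodge Theory I*, §6.1.3 Prop. 6.11, §7.1.1
  Def. 7.4 / Prop. 7.5: `V_ℂ = ⊕ V^{p,q}`, `Fᵖ = ⊕_{r ≥ p} V^{r,k-r}`; Deligne 2000, §1), recorded
  in both forms so that consumers need neither universal coefficients nor Hodge symmetry of the
  model to pass between them.
* Proved API (`namespace IsClassicalHodge`): membership forms `mem_piece_iff`, `mem_F_iff`,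
  `map_piece_le_hodgePQ`, `ofRat_mem_piece_iff`; **`mem_hodgeClasses_iff_isOfHodgeType`** /
  `mem_hodgeClasses_iff_isInHodgeFiltration`: the Hodge classes `Hdgᵖ = H²ᵖ(X) ∩ Fᵖ` of `B.hodge`
  are the rational vectors whose class `ι(B.iso v) ∈ H²ᵖ(X(ℂ); ℂ)` is of Hodge type `(p, p)` /
  lies in `Fᵖ` on the real carrier (Deligne 2000, §1), given a Hodge model.

## Scope

* Nothing here asserts that a classical datum exists (a separate construction item); consumers
  state `∀ B, B.IsClassicalHodge → …`. The three exotic re-decorations violate (i) as soon as one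
  off-diagonal Hodge number of some `X` is non-zero, so the pin is not vacuous bookkeeping.
* `comap` (preimage), not `map`: for the classical datum `Φ_A` is an isomorphism (universal
  coefficients, Hatcher Thm. 3.2 / §3.A; `X^an → X(ℂ)` a homeomorphism), so both say the same;
  `comap` is the form consumed (membership transfer both ways); `map_piece_le_hodgePQ` records the
  image inclusion. `∀ A : HodgeModel n X`: all Hodge models give the same `H^{p,q}` on `X(ℂ)`
  (module docstring of `HodgeTheory/RationalHodgeClasses`); `IsOfHodgeType` quantifies `∃ A`.
* NOT here (they need the heavy imports and stay in `PeriodRealizationClassical`): clauses (ii-a)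
  `restrictCompl_cycleClass`, (ii-b) `exists_bettiCycleData`, the bridge
  `IsClassical.hodgeConjectureFor`, and the `ofRatClass` spelling of the comparison maps.

## References

* C. Voisin, *Hodge Theory and Complex Algebraic Geometry I*, CUP 2002, §6.1.3 (Prop. 6.11),
  §7.1.1 (Def. 7.4, Prop. 7.5).
* P. Deligne, *The Hodge conjecture*, Clay Mathematics Institute (2000), §1.
* A. Hatcher, *Algebraic Topology*, CUP 2002, §3.1 p. 198, Thm. 3.2.
* J.-P. Serre, *Géométrie algébrique et géométrie analytique*, Ann. Inst. Fourier 6 (1956), §2.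
-/

open CategoryTheory AlgebraicGeometry Opposite
open scoped TensorProduct

noncomputable section

universe u

namespace Literature.AlgebraicGeometry.Motives

open Literature.AlgebraicTopology.SingularHomology Literature.AlgebraicGeometry.HodgeTheory

/-! ### The complexification `ℂ ⊗_ℚ Hᵏ(Y; ℚ) → Hᵏ(Y; ℂ)` of the change of coefficients -/

section RingChange

variable (Y : Type u) [TopologicalSpace Y] (k : ℕ)

/-- The `ℤ`-bilinear map `(c, a) ↦ c • ι(a)`, `ℂ × Hᵏ(Y; ℚ) → Hᵏ(Y; ℂ)`, bundled
(auxiliary for `ringChangeBaseChange`). [folklore] -/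
def smulRingChangeHom : ℂ →+ singularCohomology ℚ ℚ Y k →+ singularCohomology ℂ ℂ Y k :=
  ((smulAddHom ℂ (singularCohomology ℂ ℂ Y k)).flip.comp
    (singularCohomology.ringChange (algebraMap ℚ ℂ) Y k)).flip

/-- `smulRingChangeHom c a = c • ι(a)`. [folklore] -/
@[simp]
theorem smulRingChangeHom_apply (c : ℂ) (a : singularCohomology ℚ ℚ Y k) :
    smulRingChangeHom Y k c a = c • singularCohomology.ringChange (algebraMap ℚ ℂ) Y k a := rfl

/-- **Complexification of the change of coefficients** `ℂ ⊗_ℚ Hᵏ(Y; ℚ) →ₗ[ℂ] Hᵏ(Y; ℂ)`,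
`c ⊗ a ↦ c • ι(a)`, the `ℂ`-linear extension of `ι = singularCohomology.ringChange (ℚ ↪ ℂ) Y k`,
`[u] ↦ [(ℚ ↪ ℂ) ∘ u]` (Hatcher 2002, §3.1 p. 198; an isomorphism when `H_•(Y)` is finitely
generated, Thm. 3.2 / §3.A — not used; Voisin I, §7.1.1: `Hᵏ(X, ℂ) = Hᵏ(X, ℤ) ⊗ ℂ`). Built with
`TensorProduct.liftAddHom` (`Hᵏ(Y; ℂ)` carries no `Module ℚ` instance). Definitionally the same map
as `Motives.ofRatClassBaseChange` (`PeriodRealizationClassical`, `ofRatClass` spelling).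
[cite: HatcherAT2002, §3.1 p. 198] -/
def ringChangeBaseChange :
    ℂ ⊗[ℚ] singularCohomology ℚ ℚ Y k →ₗ[ℂ] singularCohomology ℂ ℂ Y k where
  toFun := TensorProduct.liftAddHom (smulRingChangeHom Y k) fun q c a ↦ by
    rw [smulRingChangeHom_apply, smulRingChangeHom_apply, ringChange_ratCast_smul, smul_smul,
      Algebra.smul_def, eq_ratCast, mul_comm]
  map_add' x y := map_add _ x y
  map_smul' c x := by
    induction x using TensorProduct.induction_on with
    | zero => rw [smul_zero, map_zero, RingHom.id_apply, smul_zero]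
    | tmul c' a =>
      rw [TensorProduct.smul_tmul', TensorProduct.liftAddHom_tmul, TensorProduct.liftAddHom_tmul,
        RingHom.id_apply, smulRingChangeHom_apply, smulRingChangeHom_apply, smul_eq_mul, mul_smul]
    | add x y hx hy => rw [smul_add, map_add, hx, hy, map_add, smul_add]

/-- `ringChangeBaseChange (c ⊗ a) = c • ι(a)`. [folklore] -/
@[simp]
theorem ringChangeBaseChange_tmul (c : ℂ) (a : singularCohomology ℚ ℚ Y k) :
    ringChangeBaseChange Y k (c ⊗ₜ a) =
      c • singularCohomology.ringChange (algebraMap ℚ ℂ) Y k a := by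
  simp only [ringChangeBaseChange, LinearMap.coe_mk, AddHom.coe_mk]
  rw [TensorProduct.liftAddHom_tmul, smulRingChangeHom_apply]

/-- On rational vectors: `ringChangeBaseChange (1 ⊗ a) = ι(a)`. [folklore] -/
theorem ringChangeBaseChange_ofRat (a : singularCohomology ℚ ℚ Y k) :
    ringChangeBaseChange Y k (HodgeStructure.ofRat a) =
      singularCohomology.ringChange (algebraMap ℚ ℂ) Y k a := by
  rw [HodgeStructure.ofRat_apply, ringChangeBaseChange_tmul, one_smul]

end RingChange

/-! ### The comparison maps of a Betti–Hodge datum -/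

namespace BettiHodgeData

section Comparison

variable {k : Type} [Field k] [Algebra k ℂ] (B : BettiHodgeData k) (X : SchemeOver k) (i : ℕ)

/-- The **comparison** `ℂ ⊗_ℚ Hⁱ(X) →ₗ[ℂ] Hⁱ(X(ℂ); ℂ)` of a Betti–Hodge datum: the composite of
`B.iso ⊗ ℂ : ℂ ⊗_ℚ Hⁱ(X) ≅ ℂ ⊗_ℚ Hⁱ(X(ℂ); ℚ)` and the complexified change of coefficients
`ringChangeBaseChange` (Voisin I, §7.1.1: `Hᵏ(X, ℂ) = Hᵏ(X, ℤ) ⊗ ℂ`; Hatcher §3.1 p. 198).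
Definitionally the same map as `BettiHodgeData.complexComparison` (`PeriodRealizationClassical`,
`ofRatClass` spelling). [cite: VoisinHodgeI2002, §7.1.1] -/
def comparison : ℂ ⊗[ℚ] B.W.obj X i →ₗ[ℂ] singularCohomology ℂ ℂ (ComplexPoints X) i :=
  ringChangeBaseChange (ComplexPoints X) i ∘ₗ (B.isoObj X i).toLinearMap.baseChange ℂ

/-- `B.comparison X i (c ⊗ v) = c • ι(B.iso v)`. [folklore] -/
@[simp]
theorem comparison_tmul (c : ℂ) (v : B.W.obj X i) :
    B.comparison X i (c ⊗ₜ v) =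
      c • singularCohomology.ringChange (algebraMap ℚ ℂ) (ComplexPoints X) i (B.isoObj X i v) := by
  simp [comparison]

/-- On rational vectors: `B.comparison X i (1 ⊗ v) = ι(B.iso v)`. [folklore] -/
theorem comparison_ofRat (v : B.W.obj X i) :
    B.comparison X i (HodgeStructure.ofRat v) =
      singularCohomology.ringChange (algebraMap ℚ ℂ) (ComplexPoints X) i (B.isoObj X i v) := by
  rw [HodgeStructure.ofRat_apply, comparison_tmul, one_smul]

end Comparison

variable (B : BettiHodgeData ℂ) {n : ℕ} {X : SchemeOver ℂ}

/-- The **comparison with a Hodge model** `A` of `X`: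
`Φ_A : ℂ ⊗_ℚ Hⁱ(X) → Hⁱ(X(ℂ); ℂ) → Hⁱ(X^an; ℂ)`, the comparison followed by the pull-back along the
analytification map `X^an → X(ℂ)` (a homeomorphism, Serre GAGA §2; `HodgeModel.pullback`).
Definitionally the same map as `BettiHodgeData.hodgeModelComparison` (`PeriodRealizationClassical`,
`ofRatClass` spelling). [cite: SerreGAGA1956, §2] -/
def modelComparison (A : HodgeModel n X) (i : ℕ) :
    ℂ ⊗[ℚ] B.W.obj X i →ₗ[ℂ] singularCohomology ℂ ℂ A.carrier i :=
  (A.pullback i).hom ∘ₗ B.comparison X i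

/-- `Φ_A (c ⊗ v) = c • φ^*(ι(B.iso v))`. [folklore] -/
@[simp]
theorem modelComparison_tmul (A : HodgeModel n X) (i : ℕ) (c : ℂ) (v : B.W.obj X i) :
    B.modelComparison A i (c ⊗ₜ v) =
      c • A.pullback i
        (singularCohomology.ringChange (algebraMap ℚ ℂ) (ComplexPoints X) i (B.isoObj X i v)) := by
  rw [modelComparison, LinearMap.comp_apply, comparison_tmul, map_smul]

/-- On rational vectors: `Φ_A (1 ⊗ v) = φ^*(ι(B.iso v))`. [folklore] -/
theorem modelComparison_ofRat (A : HodgeModel n X) (i : ℕ) (v : B.W.obj X i) :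
    B.modelComparison A i (HodgeStructure.ofRat v) =
      A.pullback i
        (singularCohomology.ringChange (algebraMap ℚ ℂ) (ComplexPoints X) i (B.isoObj X i v)) := by
  rw [HodgeStructure.ofRat_apply, modelComparison_tmul, one_smul]

/-- `Φ_A = φ^* ∘ (B.comparison X i)` pointwise. [folklore] -/
theorem modelComparison_apply (A : HodgeModel n X) (i : ℕ) (x : ℂ ⊗[ℚ] B.W.obj X i) :
    B.modelComparison A i x = A.pullback i (B.comparison X i x) := rfl

/-! ### The pin -/

/-- **`B.hodge` is the Hodge structure of `X^an`** (the HODGE-STRUCTURE PIN of a Betti–Hodge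
datum; hypothesis predicate — exactly clauses (i)/(i') of `BettiHodgeData.IsClassical`): for every
smooth projective `X` of dimension `n`, every Hodge model `A` of `X` and every degree `i`, the
Hodge pieces `V^{p,q}` (`p + q = i`) and the Hodge filtration `Fʳ` of `B.hodge hX i` on
`ℂ ⊗_ℚ Hⁱ(X)`, `Hⁱ(X) ≅ Hⁱ(X(ℂ); ℚ)`, are the preimages of `H^{p,q}(X^an)` and of
`Fʳ Hⁱ(X^an) = ⊕_{p ≥ r} H^{p,i-p}` under `Φ_A = B.modelComparison A i : ℂ ⊗_ℚ Hⁱ(X) → Hⁱ(X^an; ℂ)`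
— i.e. `B.hodge hX i` IS the Hodge structure of weight `i` of the compact Kähler manifold `X^an`
in both of Voisin's equivalent descriptions (Voisin I, §6.1.3 Prop. 6.11; §7.1.1 Def. 7.4 and
Prop. 7.5: `V_ℂ = ⊕ V^{p,q}`, `Fᵖ V_ℂ = ⊕_{r ≥ p} V^{r,k-r}`; Deligne 2000, §1). No instance exists
in the tree; consumers state `B.IsClassicalHodge → …`; `BettiHodgeData.IsClassical` implies it
(`IsClassical.isClassicalHodge`, `PeriodRealizationClassical`: its clauses (i)/(i') are these two,
verbatim up to the definitional equality `hodgeModelComparison = modelComparison`).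
[cite: VoisinHodgeI2002, §7.1.1 Def. 7.4 and Prop. 7.5] -/
structure IsClassicalHodge (B : BettiHodgeData ℂ) : Prop where
  /-- (i) The Hodge pieces of `B.hodge hX i` are the preimages of the `H^{p,q}(X^an)` of every Hodge
  model under `Φ_A` (Voisin I, §6.1.3 Prop. 6.11 and §7.1.1 Def. 7.4). -/
  comap_hodgePQ : ∀ ⦃n : ℕ⦄ ⦃X : SchemeOver ℂ⦄ (hX : IsSmoothProjective n X) (A : HodgeModel n X)
    ⦃i p q : ℕ⦄, p + q = i →
      (A.hodgePQ i p q).comap (B.modelComparison A i) = (B.hodge hX i).piece p q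
  /-- (i') The Hodge filtration of `B.hodge hX i` is the preimage of
  `Fʳ Hⁱ(X^an) = ⊕_{p ≥ r} H^{p,i-p}` of every Hodge model under `Φ_A` (Voisin I, §7.1.1 Def. 7.4
  and Prop. 7.5). -/
  comap_hodgeFiltration : ∀ ⦃n : ℕ⦄ ⦃X : SchemeOver ℂ⦄ (hX : IsSmoothProjective n X)
    (A : HodgeModel n X) (i r : ℕ),
      (A.hodgeFiltration i r).comap (B.modelComparison A i) = (B.hodge hX i).F r

namespace IsClassicalHodge

variable {B}

/-- Membership form of (i): `x ∈ V^{p,q} ↔ Φ_A x ∈ H^{p,q}(X^an)`.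
[cite: VoisinHodgeI2002, §7.1.1 Def. 7.4] -/
theorem mem_piece_iff (h : B.IsClassicalHodge) (hX : IsSmoothProjective n X) (A : HodgeModel n X)
    {i p q : ℕ} (hpq : p + q = i) (x : ℂ ⊗[ℚ] B.W.obj X i) :
    x ∈ (B.hodge hX i).piece p q ↔ B.modelComparison A i x ∈ A.hodgePQ i p q := by
  rw [← h.comap_hodgePQ hX A hpq, Submodule.mem_comap]

/-- Membership form of (i'): `x ∈ Fʳ ↔ Φ_A x ∈ Fʳ Hⁱ(X^an)`.
[cite: VoisinHodgeI2002, §7.1.1 Def. 7.4] -/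
theorem mem_F_iff (h : B.IsClassicalHodge) (hX : IsSmoothProjective n X) (A : HodgeModel n X)
    (i r : ℕ) (x : ℂ ⊗[ℚ] B.W.obj X i) :
    x ∈ (B.hodge hX i).F r ↔ B.modelComparison A i x ∈ A.hodgeFiltration i r := by
  rw [← h.comap_hodgeFiltration hX A i r, Submodule.mem_comap]

/-- Image form of (i): `Φ_A (V^{p,q}) ⊆ H^{p,q}(X^an)`. [cite: VoisinHodgeI2002, §7.1.1 Def. 7.4] -/
theorem map_piece_le_hodgePQ (h : B.IsClassicalHodge) (hX : IsSmoothProjective n X)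
    (A : HodgeModel n X) {i p q : ℕ} (hpq : p + q = i) :
    ((B.hodge hX i).piece p q).map (B.modelComparison A i) ≤ A.hodgePQ i p q := by
  rw [Submodule.map_le_iff_le_comap, h.comap_hodgePQ hX A hpq]

/-- Image form of (i'): `Φ_A (Fʳ) ⊆ Fʳ Hⁱ(X^an)`. [cite: VoisinHodgeI2002, §7.1.1 Def. 7.4] -/
theorem map_F_le_hodgeFiltration (h : B.IsClassicalHodge) (hX : IsSmoothProjective n X)
    (A : HodgeModel n X) (i r : ℕ) :
    ((B.hodge hX i).F r).map (B.modelComparison A i) ≤ A.hodgeFiltration i r := by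
  rw [Submodule.map_le_iff_le_comap, h.comap_hodgeFiltration hX A i r]

/-- A rational vector `v ∈ Hⁱ(X)` lies in `V^{p,q}` iff the class `ι(B.iso v)` is of Hodge type
`(p, q)` in the Hodge model `A`. [cite: VoisinHodgeI2002, §7.1.1] -/
theorem ofRat_mem_piece_iff (h : B.IsClassicalHodge) (hX : IsSmoothProjective n X)
    (A : HodgeModel n X) {i p q : ℕ} (hpq : p + q = i) (v : B.W.obj X i) :
    HodgeStructure.ofRat v ∈ (B.hodge hX i).piece p q ↔
      A.pullback i (singularCohomology.ringChange (algebraMap ℚ ℂ) (ComplexPoints X) i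
        (B.isoObj X i v)) ∈ A.hodgePQ i p q := by
  rw [h.mem_piece_iff hX A hpq, modelComparison_ofRat]

/-- A rational vector `v ∈ Hⁱ(X)` lies in `Fʳ` iff the class `ι(B.iso v)` lies in `Fʳ Hⁱ(X^an)` in
the Hodge model `A`. [cite: VoisinHodgeI2002, §7.1.1] -/
theorem ofRat_mem_F_iff (h : B.IsClassicalHodge) (hX : IsSmoothProjective n X)
    (A : HodgeModel n X) (i r : ℕ) (v : B.W.obj X i) :
    HodgeStructure.ofRat v ∈ (B.hodge hX i).F r ↔
      A.pullback i (singularCohomology.ringChange (algebraMap ℚ ℂ) (ComplexPoints X) i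
        (B.isoObj X i v)) ∈ A.hodgeFiltration i r := by
  rw [h.mem_F_iff hX A i r, modelComparison_ofRat]

/-- **The Hodge classes of a pinned datum are the rational `(p,p)`-classes of the real carrier**:
`v ∈ Hdgᵖ(B, X) = H²ᵖ(X) ∩ Fᵖ` iff the class `ι(B.iso v) ∈ H²ᵖ(X(ℂ); ℂ)` is of Hodge type
`(p, p)` (`HodgeTheory.IsOfHodgeType`, through some / any Hodge model), given a Hodge model (`hA`;
the tree's named fact `HodgeTheory.nonempty_hodgeModel`). Deligne 2000, §1: "Hodge classes …
`H²ᵖ(X, ℚ) ∩ H^{p,p}(X) = H²ᵖ(X, ℚ) ∩ Fᵖ`". [cite: Deligne2000, §1] -/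
theorem mem_hodgeClasses_iff_isOfHodgeType (h : B.IsClassicalHodge) (hX : IsSmoothProjective n X)
    (hA : Nonempty (HodgeModel n X)) (p : ℕ) (v : B.W.obj X (2 * p)) :
    v ∈ (B.hodge hX (2 * p)).hodgeClasses p ↔
      IsOfHodgeType n X (2 * p) p p
        (singularCohomology.ringChange (algebraMap ℚ ℂ) (ComplexPoints X) (2 * p)
          (B.isoObj X (2 * p) v)) := by
  have h2 : (p : ℤ) + p = ((2 * p : ℕ) : ℤ) := by push_cast; ring
  constructor
  · intro hv
    obtain ⟨A⟩ := hA
    exact ⟨A, (h.ofRat_mem_piece_iff hX A (two_mul p).symm v).1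
      ((B.hodge hX (2 * p)).ofRat_mem_piece_of_mem_hodgeClasses h2 hv)⟩
  · rintro ⟨A, hA'⟩
    rw [HodgeStructure.mem_hodgeClasses_iff]
    exact (B.hodge hX (2 * p)).piece_le_F p p
      ((h.ofRat_mem_piece_iff hX A (two_mul p).symm v).2 hA')

/-- Filtration form: `v ∈ Hⁱ(X) ∩ Fʳ` (`(B.hodge hX i).hodgeClasses r`) iff the class
`ι(B.iso v) ∈ Hⁱ(X(ℂ); ℂ)` lies in `Fʳ` of some / any Hodge model
(`HodgeTheory.IsInHodgeFiltration`), given a Hodge model (`hA`). Deligne 2000, §1: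
`H²ᵖ(X, ℚ) ∩ Fᵖ`. [cite: Deligne2000, §1] -/
theorem mem_hodgeClasses_iff_isInHodgeFiltration (h : B.IsClassicalHodge)
    (hX : IsSmoothProjective n X) (hA : Nonempty (HodgeModel n X)) (i r : ℕ) (v : B.W.obj X i) :
    v ∈ (B.hodge hX i).hodgeClasses r ↔
      IsInHodgeFiltration n X i r
        (singularCohomology.ringChange (algebraMap ℚ ℂ) (ComplexPoints X) i (B.isoObj X i v)) := by
  rw [HodgeStructure.mem_hodgeClasses_iff]
  constructor
  · intro hv
    obtain ⟨A⟩ := hA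
    exact ⟨A, (h.ofRat_mem_F_iff hX A i r v).1 hv⟩
  · rintro ⟨A, hA'⟩
    exact (h.ofRat_mem_F_iff hX A i r v).2 hA'

end IsClassicalHodge

end BettiHodgeData

end Literature.AlgebraicGeometry.Motives

end
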